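import Mathlib.LinearAlgebra.FiniteDimensional.Lemmas
import Mathlib.LinearAlgebra.Dimension.Constructions
import Mathlib.LinearAlgebra.Prod
import Mathlib.Data.Finset.Powerset
import Mathlib.Data.Nat.Choose.Basic
import Mathlib.Tactic
import HarnessLib

/-!
# Markman's weak semiregularity criterion on abelian varieties: the linear-algebra and arithmetic skeleton

Family `hodge`, layer `Literature/AlgebraicGeometry/HodgeTheory`. Companion to `SemiregularityWeakCriterion.lean` (the weak criterion (W):
`σ_E` injective on `im ob_E`, [`Markman2025SecantWeilSurvey`, Lemma 11.3 / Question 11.4]; [Markman, arXiv:2502.03415v2, §8.3, Lemma 8.3.4,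
Remarks 8.3.5–8.3.6]), to `SemiregularityWeakCriterionRationalSurface.lean` and `SemiregularityWeakCriterionK3.lean` (Question 11.4 is false
as stated: rational and K3 surfaces). Ladder note `papers/HodgeConjecture/hodge-weil-ladder`, section "Question 11.4″(a) on abelian
varieties" (`Q114-ABELIAN.md`). The surviving form of the question — 11.4″(a): does the Semiregularity Theorem hold under (W) for sheaves on
ABELIAN varieties? — is analysed there in two halves; this file kernel-checks the finite-dimensional statements the analysis rests on. The
geometric identifications (of the maps below with `ob_E`, `σ_E`, `⌟ch(E)`, and of the index bookkeeping with the obstruction map of the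
coordinate cross) are paper-level, exactly as in the two companion certificates.

STRUCTURAL HALF. `rank_squeeze`: if `dim Ext²(E,E) ≤ rank(σ ∘ ob)` then `ob` is surjective, `σ` injective and `ker ob = ker(σ ∘ ob)` — both
hypotheses AND the conclusion of Lemma 11.3. On an abelian variety `Y` of dimension `n` this applies to `E = 𝒪_A`, `A ⊂ Y` an abelian
subvariety of dimension `a`, codimension `c`: `Ext²(𝒪_A,𝒪_A) = ⊕_{i+j=2} ∧ʲ(V/V_A) ⊗ Hⁱ(A,𝒪)` has dimension `C(c,2) + ac + C(a,2)`, and `⌟[A]`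
has rank `C(a,2)` on `H²(𝒪)`, `ac` on `H¹(T)`, `C(c,2)` on `H⁰(∧²T)` in three distinct bidegrees; `choose_two_add` is the identity
`C(a,2) + ac + C(c,2) = C(a+c,2) = dim Ext²`. So abelian subvarieties are semiregular with surjective obstruction map (note, Prop. AS). For
semi-homogeneous bundles `E` of slope `H` (Mukai 1978 [`Mukai1978`, Props. 6.2/6.18, Prop. 6.17/Cor. 6.23/Thm. 5.8], as restated in
Gross–Kaur–Ulirsch–Werner [`GrossEtAl2023`] — arXiv:2312.12980v2 NUMBERING (the held corpus text): Thm. 1.5 (structure), Thm. 1.7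
(existence, uniqueness up to `Pic⁰`, `E = f_*L`), Lemma 1.16 (`Extⁱ(E, E′) = 0` for non-isomorphic `E, E′ ∈ M_{H,1}`), Thm. 1.17 (the
universal bundle on `M_{H,1}(A) × A` is a Fourier–Mukai kernel, finite length `k` ↔ slope `H`, rank `k·n(H)`); v1 numbers the first
three the same and has the Fourier–Mukai statement inside the proof of its Thm. 1.17; the JOURNAL version Moduli 3, e8 (2026) = v3 §1 ↦ §2
prints Thms. 2.4, 2.6 (= v2 1.5, 1.7) and Thm. 2.16 (moduli), keeps the Fourier–Mukai transform only inside the proof of Prop. 2.11 for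
`H ∈ NS(A)` (kernel the universal line bundle `P_H` on `A × Pic^H(A)`), and drops the `Ext`-vanishing lemma) the
Atiyah class is scalar, `at_E = H·id_E`, hence `ob_E(u) = c_H(u)·id_E` and `σ_E(e) = e^H ∪ Tr(e)`: (W) always holds, `E` is semiregular iff
`Ext²(E,E) = H²(𝒪)·id_E` (simple `E`: yes; `E′ ⊕ E″` or `U₂ ⊗ F`: no, `two_summands_not_semiregular_count`), and every semi-homogeneous `E`
deforms along the Hodge locus of `H` (note, Thm. S). `weakCriterion_prod_iff`: for a direct sum with proportional Chern characters (W) holds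
iff it holds for both summands — the linear algebra behind the (negative) answer to the FIRST sentence of Question 11.4.

COUNTEREXAMPLE HALF. The abelian analogue of the K3 mechanism is the Matsusaka–Ran habitat: on a ppav of dimension `g ≥ 4` the minimal class
`θ^{g−1}/(g−1)!` is Hodge everywhere and effective only on products of Jacobians [Lange–Birkenhake, Complex Abelian Varieties, Thm 4.7.1], so a
one-dimensional sheaf of minimal class DIES along a general principally polarized arc (note, Thm. M). But there (W) FAILS: for an invertible
sheaf on an Abel–Jacobi configuration `Z`, (W) ⟺ `Z` lifts to first order along every direction of `Sym²V = T𝔥_g` (note, Lemma W1), and the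
liftable directions are exactly the image of the differential of the (extended) Torelli map. `defect_nonhyp_eq` / `defect_hyp_eq` and their
positivity statements are the counts for smooth curves (`g(g+1)/2 − (3g−3) = (g−2)(g−3)/2 > 0 ⟺ g ≥ 4`; hyperelliptic `(g−1)(g−2)/2 > 0 ⟺
g ≥ 3`); `ellipticTail_defect` the count `10 − 8 = 2` at `J(C₁) × E`; and `star_ob_eq_zero_iff`, `star_symm_offdiag_obstructed`,
`star_diag_unobstructed`, `card_offdiag_pairs`, `star_defect_eq` encode the obstruction map of the coordinate cross `Z = A₁ ∪ ⋯ ∪ A_g ⊂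
E₁ × ⋯ × E_g`: with `𝓝_Z ≅ ⊕_l N_{A_l}` one has `ob_Z(a_j ⊗ ∂_k) = a_j ⊗ [∂_k]` in the summand `l = j`, i.e. on coordinates `x(l,k)` the map
kills the diagonal and keeps every off-diagonal entry; its kernel on symmetric tensors is the diagonal, so all `C(g,2)` off-diagonal
principally polarized directions are obstructed (note, Prop. C). `fano_surface_moduli_count`, `ribbon_defect_pos_iff`,
`ribbon_window_four`: the counts behind the moduli-count corollary (note §2.7) and the ribbon lemma (note §2.9: double structures on
Abel–Jacobi curves, the habitat of TWICE the minimal class, where death comes from Welters 1987).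
-/

namespace Literature.AlgebraicGeometry.HodgeTheory.WeakCriterionAbelian

section RankSqueeze

variable {𝕜 : Type*} [Field 𝕜] {H E Ω : Type*} [AddCommGroup H] [Module 𝕜 H] [AddCommGroup E] [Module 𝕜 E]
  [AddCommGroup Ω] [Module 𝕜 Ω]

/-- LEMMA R (rank squeeze). `ev : HT² → Ext²(E,E)` the obstruction map, `σ : Ext²(E,E) → HΩ_{−2}` the semiregularity map, `σ ∘ ev = ⌟ch(E)`
(Buchweitz–Flenner; [Markman 2502.03415 §8.3]). If `dim Ext²(E,E) ≤ rank(σ ∘ ev)` then `ev` is SURJECTIVE, `σ` is INJECTIVE (E is semiregular)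
and `ker ev = ker(σ ∘ ev)` (= `ann ch(E)`): both hypotheses and the conclusion of [Markman, Lemma 8.3.4 / survey Lemma 11.3]. Used for
structure sheaves of abelian subvarieties (`choose_two_add`), simple semi-homogeneous bundles, skyscrapers and genus-3 Abel–Jacobi curves.
[folklore] -/
theorem rank_squeeze [FiniteDimensional 𝕜 E] (ev : H →ₗ[𝕜] E) (σ : E →ₗ[𝕜] Ω)
    (h : Module.finrank 𝕜 E ≤ Module.finrank 𝕜 (LinearMap.range (σ ∘ₗ ev))) :
    Function.Surjective ev ∧ Function.Injective σ ∧ LinearMap.ker ev = LinearMap.ker (σ ∘ₗ ev) := by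
  have hcomp : LinearMap.range (σ ∘ₗ ev) = (LinearMap.range ev).map σ := LinearMap.range_comp ev σ
  have h1 : Module.finrank 𝕜 (LinearMap.range (σ ∘ₗ ev)) ≤ Module.finrank 𝕜 (LinearMap.range ev) := by
    rw [hcomp]; exact Submodule.finrank_map_le σ (LinearMap.range ev)
  have h2 : Module.finrank 𝕜 (LinearMap.range ev) ≤ Module.finrank 𝕜 E := Submodule.finrank_le _
  have hrange : LinearMap.range ev = ⊤ := Submodule.eq_top_of_finrank_eq (le_antisymm h2 (h.trans h1))
  have hsurj : Function.Surjective ev := LinearMap.range_eq_top.mp hrange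
  have h3 : Module.finrank 𝕜 (LinearMap.range (σ ∘ₗ ev)) ≤ Module.finrank 𝕜 (LinearMap.range σ) :=
    Submodule.finrank_mono (LinearMap.range_comp_le_range ev σ)
  have h4 := LinearMap.finrank_range_add_finrank_ker σ
  have hker0 : Module.finrank 𝕜 (LinearMap.ker σ) = 0 := by omega
  have hinj : Function.Injective σ := LinearMap.ker_eq_bot.mp (Submodule.finrank_eq_zero.mp hker0)
  refine ⟨hsurj, hinj, ?_⟩
  ext u
  simp only [LinearMap.mem_ker, LinearMap.coe_comp, Function.comp_apply]
  constructor
  · intro hu; rw [hu, map_zero]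
  · intro hu; exact hinj (by rw [hu, map_zero])

end RankSqueeze

section DirectSum

variable {𝕜 : Type*} [Field 𝕜] {H E₁ E₂ Ω : Type*} [AddCommGroup H] [Module 𝕜 H] [AddCommGroup E₁] [Module 𝕜 E₁]
  [AddCommGroup E₂] [Module 𝕜 E₂] [AddCommGroup Ω] [Module 𝕜 Ω]

/-- LEMMA Σ (direct sums). For `E = E₁ ⊕ E₂` the obstruction map is `ev₁ × ev₂` into `Ext²(E₁,E₁) ⊕ Ext²(E₂,E₂) ⊂ Ext²(E,E)` and the
semiregularity map restricted there is `σ₁ ⊕ σ₂ ↦ σ₁ + σ₂`. If the two summands have the same `⌟ch` (`σ₁ ∘ ev₁ = σ₂ ∘ ev₂`, e.g. `E₂ = E₁ ⊗ P`,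
`P ∈ Pic⁰`, or after rescaling proportional Chern characters) and `2 ≠ 0`, then (W) for `E` (in the form of `SemiregularityWeakCriterion.lean`:
`σ (ev u) = 0 → ev u = 0`) holds iff it holds for BOTH summands. This is the linear algebra of the first sentence of Question 11.4 (is
surjectivity of `ev_E` needed in Lemma 11.3? yes: `L ⊕ L⊗P₀`, `f_*L′ ⊕ f_*L′` satisfy (W) and are not semiregular). [folklore] -/
theorem weakCriterion_prod_iff (ev₁ : H →ₗ[𝕜] E₁) (ev₂ : H →ₗ[𝕜] E₂) (σ₁ : E₁ →ₗ[𝕜] Ω) (σ₂ : E₂ →ₗ[𝕜] Ω)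
    (h2 : (2 : 𝕜) ≠ 0) (hch : σ₁ ∘ₗ ev₁ = σ₂ ∘ₗ ev₂) :
    (∀ u, (σ₁.coprod σ₂) ((ev₁.prod ev₂) u) = 0 → (ev₁.prod ev₂) u = 0) ↔
      (∀ u, σ₁ (ev₁ u) = 0 → ev₁ u = 0) ∧ (∀ u, σ₂ (ev₂ u) = 0 → ev₂ u = 0) := by
  have hc : ∀ u, σ₂ (ev₂ u) = σ₁ (ev₁ u) := fun u => by
    have := congrArg (fun f => f u) hch
    simpa using this.symm
  have e1 : ∀ u, (σ₁.coprod σ₂) ((ev₁.prod ev₂) u) = σ₁ (ev₁ u) + σ₂ (ev₂ u) := fun u => rfl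
  have e2 : ∀ u, ((ev₁.prod ev₂) u = 0) ↔ (ev₁ u = 0 ∧ ev₂ u = 0) := fun u => by
    change (ev₁ u, ev₂ u) = 0 ↔ _
    exact Prod.mk_eq_zero
  simp only [e1, e2]
  constructor
  · intro hW
    refine ⟨fun u hu => (hW u (by rw [hc u, hu, add_zero])).1, fun u hu => (hW u ?_).2⟩
    rw [hc u] at hu; rw [hc u, hu, add_zero]
  · rintro ⟨hW₁, hW₂⟩ u hu
    rw [hc u, ← two_smul 𝕜] at hu
    have h0 : σ₁ (ev₁ u) = 0 := by
      rcases smul_eq_zero.mp hu with h | h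
      · exact absurd h h2
      · exact h
    exact ⟨hW₁ u h0, hW₂ u (by rw [hc u, h0])⟩

/-- The witness form (no hypothesis on the Chern characters): if some `u` keeps `ch(E₁) + ch(E₂)` infinitesimally Hodge
(`σ₁(ev₁ u) + σ₂(ev₂ u) = 0`) but obstructs `E₁` (`ev₁ u ≠ 0`), then (W) fails for `E₁ ⊕ E₂`. Instances in the note: `𝒪(A) ⊕ 𝒪(B)` on
`E₁ × E₂`; `𝒪_{W×0} ⊕ 𝒪_{0×E}` on `J(C₁) × E`. [folklore] -/
theorem not_weakCriterion_prod_of_witness (ev₁ : H →ₗ[𝕜] E₁) (ev₂ : H →ₗ[𝕜] E₂) (σ₁ : E₁ →ₗ[𝕜] Ω) (σ₂ : E₂ →ₗ[𝕜] Ω)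
    (u : H) (hsum : σ₁ (ev₁ u) + σ₂ (ev₂ u) = 0) (hne : ev₁ u ≠ 0) :
    ¬ ∀ v, (σ₁.coprod σ₂) ((ev₁.prod ev₂) v) = 0 → (ev₁.prod ev₂) v = 0 := by
  intro hW
  have e1 : (σ₁.coprod σ₂) ((ev₁.prod ev₂) u) = σ₁ (ev₁ u) + σ₂ (ev₂ u) := rfl
  have h := hW u (by rw [e1, hsum])
  have e2 : ((ev₁.prod ev₂) u = 0) ↔ (ev₁ u = 0 ∧ ev₂ u = 0) := by
    change (ev₁ u, ev₂ u) = 0 ↔ _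
    exact Prod.mk_eq_zero
  exact hne ((e2.mp h).1)

end DirectSum

section Counts

/-- PROPOSITION AS, the count. For an abelian subvariety `A ⊂ Y` of dimension `a` and codimension `c`: `dim Ext²(𝒪_A,𝒪_A) =
C(c,2) + a·c + C(a,2)` (`∧²(V/V_A) ⊕ (V/V_A ⊗ H¹(𝒪_A)) ⊕ H²(𝒪_A)`), and `⌟[A]` has rank `C(a,2)` on `H²(𝒪_Y)`, `a·c` on `H¹(T_Y)`, `C(c,2)` on
`H⁰(∧²T_Y)`, in three different bidegrees. Vandermonde: the total is `C(a+c,2) = C(n,2)`, so `rank_squeeze` applies: `𝒪_A` is semiregular with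
surjective obstruction map and `ker ob = ann([A])`. [folklore] -/
theorem choose_two_add (a c : ℕ) : (a + c).choose 2 = a.choose 2 + a * c + c.choose 2 := by
  induction c with
  | zero => simp
  | succ c ih =>
    rw [Nat.add_succ, Nat.choose_succ_succ, ih, Nat.choose_succ_succ c 1, Nat.choose_one_right,
      Nat.choose_one_right]
    ring

/-- `dim HT²(Y) = C(n,2) + n² + C(n,2) = n(2n−1) = dim HH²(Y)` for an abelian variety (or torus) of dimension `n`
(`HT² = H²(𝒪) ⊕ H¹(T) ⊕ H⁰(∧²T)`, `HH² = ∧²` of a `2n`-dimensional space). [folklore] -/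
theorem htwo_dim (n : ℕ) : n.choose 2 + n * n + n.choose 2 = (2 * n).choose 2 := by
  have := choose_two_add n n
  rw [two_mul]; omega

/-- PROPOSITION A, non-hyperelliptic count. For a smooth non-hyperelliptic curve `C` of genus `g` in its Jacobian, an invertible sheaf on the
Abel–Jacobi curve lifts to first order exactly along `im dτ_C ⊂ Sym²H¹(𝒪_C)` (rank `3g−3`, Max Noether), so the (W)-defect is
`g(g+1)/2 − (3g−3) = (g−2)(g−3)/2`. [folklore] -/
theorem defect_nonhyp_eq (g : ℚ) : g * (g + 1) / 2 - (3 * g - 3) = (g - 2) * (g - 3) / 2 := by ring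

/-- … which is positive iff `g ≥ 4` (for `g ≥ 2`): (W) fails for Abel–Jacobi curves of every non-hyperelliptic curve of genus `≥ 4` and holds
(with semiregularity, [Markman 2502.03415 Lemma 8.3.7]) in genus `3`. Stated as `2·defect = g(g+1) − 2(3g−3) > 0`. [folklore] -/
theorem defect_nonhyp_pos_iff (g : ℤ) (hg : 2 ≤ g) : 0 < g * (g + 1) - 2 * (3 * g - 3) ↔ 4 ≤ g := by
  constructor
  · intro h
    by_contra hlt
    have hlt' : g < 4 := lt_of_not_ge hlt
    interval_cases g <;> omega
  · intro h; nlinarith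

/-- PROPOSITION A, hyperelliptic count: `im dτ_C` has rank `2g−1`, defect `g(g+1)/2 − (2g−1) = (g−1)(g−2)/2`. [folklore] -/
theorem defect_hyp_eq (g : ℚ) : g * (g + 1) / 2 - (2 * g - 1) = (g - 1) * (g - 2) / 2 := by ring

/-- … positive iff `g ≥ 3` (for `g ≥ 2`): (W) fails for the Abel–Jacobi curve of every hyperelliptic curve of genus `≥ 3`. [folklore] -/
theorem defect_hyp_pos_iff (g : ℤ) (hg : 2 ≤ g) : 0 < g * (g + 1) - 2 * (2 * g - 1) ↔ 3 ≤ g := by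
  constructor
  · intro h
    by_contra hlt
    have hlt' : g < 3 := lt_of_not_ge hlt
    interval_cases g; omega
  · intro h; nlinarith

/-- PROPOSITION B, the count at an elliptic-tail point `J(C₁) × E` (`g(C₁) = 3` non-hyperelliptic, total genus 4): `T𝔥₄ = Sym²V_Y ⊕ V_Y⊗V_E ⊕
Sym²V_E` has dimension `C(5,2) = 6 + 3 + 1 = 10`; the liftable directions of the nodal Abel–Jacobi curve `Z_p = W×0 ∪ 0×E` are `Sym²V_Y ⊕ Sym²V_E
⊕ ℂ·ξ_{φ_K(p)}` (dimension `6 + 1 + 1 = 8`): defect `2`, the two obstructed normal directions being `ξ_v`, `v ∉ T_0W`, detected in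
`H¹(𝒪_W(p)) ⊗ V_E ≅ (V_Y/ℂφ_K(p)) ⊗ V_E`. [folklore] -/
theorem ellipticTail_defect :
    Nat.choose 5 2 = Nat.choose 4 2 + 3 * 1 + Nat.choose 2 2 ∧ Nat.choose 4 2 + 3 * 1 + Nat.choose 2 2 = 10 ∧
      10 - (Nat.choose 4 2 + Nat.choose 2 2 + 1) = 2 ∧ (3 - 1) * 1 = 2 := by
  decide

/-- The same count in genus `g ≥ 4` (elliptic tail on a generic curve `C₁` of genus `g−1 ≥ 3`: liftable = `im dτ_{C₁}` (`3g−6`) `+ 1 + 1`):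
defect `g(g+1)/2 − (3g−4) = (g² − 5g + 8)/2 = ((g−1)(g−4) + 4)/2 ≥ 2`. [folklore] -/
theorem ellipticTail_defect_general (g : ℚ) (hg : 4 ≤ g) :
    g * (g + 1) / 2 - ((3 * (g - 1) - 3) + 1 + 1) = (g ^ 2 - 5 * g + 8) / 2 ∧ 2 ≤ (g ^ 2 - 5 * g + 8) / 2 := by
  constructor
  · ring
  · nlinarith [mul_nonneg (show (0:ℚ) ≤ g - 1 by linarith) (show (0:ℚ) ≤ g - 4 by linarith)]

/-- THEOREM S (S3), the count. A semi-homogeneous `E` on an abelian `g`-fold is semiregular iff `Ext²(E,E) = H²(𝒪)·id_E`, i.e. iff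
`ext²(E,E) = C(g,2)`. For `E = E′ ⊕ E″` one has `ext² ≥ 2·C(g,2)`, and for `E = U₂ ⊗ F` (`U₂` the non-split self-extension of `𝒪`) `ext² ≥
ext²(U₂,U₂) = ext²(𝒪_Z,𝒪_Z) = 2·C(g,2)` (`Z ≅ Spec k[ε]` a complete intersection on the dual, `Ext^*(𝒪_Z,𝒪_Z) = ∧^*k^g ⊗ k[ε]`): both exceed
`C(g,2)` as soon as `g ≥ 2`, so these are NOT semiregular although they satisfy (W). [folklore] -/
theorem two_summands_not_semiregular_count (g : ℕ) (hg : 2 ≤ g) : g.choose 2 < 2 * g.choose 2 := by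
  have := Nat.choose_pos hg
  omega

end Counts

section Star

variable {𝕜 : Type*} [Field 𝕜] {g : ℕ}

/-- PROPOSITION C (the coordinate cross `Z = A₁ ∪ ⋯ ∪ A_g ⊂ E₁ × ⋯ × E_g`, `g ≥ 3`). With `𝓝_Z ≅ ⊕_l N_{A_l} = ⊕_l 𝒪_{A_l} ⊗ V/V_l` and
`H¹(T) ∋ Σ x(j,k)·a_j ⊗ ∂_k`, the obstruction map `ob_Z : H¹(T) → H¹(𝓝_Z) = ⊕_l V/V_l` sends `a_j ⊗ ∂_k` to `a_j ⊗ [∂_k]` in the summand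
`l = j` (zero iff `k = j`): on coordinates it kills the diagonal and keeps every off-diagonal entry. We axiomatise exactly that (`hob`) for an
arbitrary linear map and read off the kernel: `ob x = 0` iff all off-diagonal coordinates of `x` vanish — the liftable directions are the
"diagonal" ones `T(𝒜₁^g)` (deform each `E_j`). [folklore] -/
theorem star_ob_eq_zero_iff (ob : (Fin g × Fin g → 𝕜) →ₗ[𝕜] (Fin g × Fin g → 𝕜))
    (hob : ∀ x l k, ob x (l, k) = if k = l then 0 else x (l, k)) (x : Fin g × Fin g → 𝕜) :
    ob x = 0 ↔ ∀ j k, j ≠ k → x (j, k) = 0 := by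
  constructor
  · intro h j k hjk
    have hx := congrFun h (j, k)
    rw [hob, Pi.zero_apply, if_neg (Ne.symm hjk)] at hx
    exact hx
  · intro h
    funext p
    obtain ⟨l, k⟩ := p
    rw [hob, Pi.zero_apply]
    by_cases hkl : k = l
    · rw [if_pos hkl]
    · rw [if_neg hkl]; exact h l k (fun e => hkl e.symm)

/-- Every SYMMETRIC OFF-DIAGONAL direction `a_j ⊗ ∂_k + a_k ⊗ ∂_j` (`j ≠ k`) — a principally polarized first-order deformation of
`E₁ × ⋯ × E_g` moving the period matrix off the diagonal — is OBSTRUCTED for the coordinate cross: `ob_Z` of it has the two non-zero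
components `a_j ⊗ [∂_k]`, `a_k ⊗ [∂_j]`. So (W) fails for every invertible sheaf on `Z` (note, Lemma W1 + Prop. C). [folklore] -/
theorem star_symm_offdiag_obstructed (ob : (Fin g × Fin g → 𝕜) →ₗ[𝕜] (Fin g × Fin g → 𝕜))
    (hob : ∀ x l k, ob x (l, k) = if k = l then 0 else x (l, k)) {j k : Fin g} (hjk : j ≠ k) :
    ob (Pi.single (j, k) 1 + Pi.single (k, j) 1) ≠ 0 := by
  intro h
  rw [star_ob_eq_zero_iff ob hob] at h
  have hx := h j k hjk
  have hne : (j, k) ≠ (k, j) := fun e => hjk (Prod.mk.inj e).1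
  rw [Pi.add_apply, Pi.single_eq_same, Pi.single_eq_of_ne hne, add_zero] at hx
  exact one_ne_zero hx

/-- … while the DIAGONAL directions `a_j ⊗ ∂_j` (deforming the factor `E_j`) are unobstructed: `ker ob_Z ∩ Sym²V` is exactly the
`g`-dimensional diagonal `T(𝒜₁^g)`. [folklore] -/
theorem star_diag_unobstructed (ob : (Fin g × Fin g → 𝕜) →ₗ[𝕜] (Fin g × Fin g → 𝕜))
    (hob : ∀ x l k, ob x (l, k) = if k = l then 0 else x (l, k)) (j : Fin g) :
    ob (Pi.single (j, j) 1) = 0 := by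
  rw [star_ob_eq_zero_iff ob hob]
  intro l k hlk
  exact Pi.single_eq_of_ne (fun e => hlk (by have := Prod.mk.inj e; exact this.1.symm ▸ this.2.symm ▸ rfl)) _

/-- The number of obstructed symmetric off-diagonal directions `{j,k}`, `j ≠ k`, is `C(g,2)` (`6` for `g = 4`). [folklore] -/
theorem card_offdiag_pairs (g : ℕ) : ((Finset.univ : Finset (Fin g)).powersetCard 2).card = g.choose 2 := by
  rw [Finset.card_powersetCard, Finset.card_univ, Fintype.card_fin]

/-- The (W)-defect of the coordinate cross: `dim Sym²V − dim(diagonal) = C(g+1,2) − g = C(g,2) = g(g−1)/2` — every principally polarized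
direction transverse to `𝒜₁^g` is obstructed; for `g = 4` the defect is `6` (of `10`), for the elliptic tail it was `2`, for a smooth
non-hyperelliptic genus-4 curve `1`: the defect equals the corank of the differential of the extended Torelli map at the corresponding stable
curve ("(W) sees exactly the first-order Schottky relations"). [folklore] -/
theorem star_defect_eq (g : ℕ) : (g + 1).choose 2 - g = g.choose 2 ∧ Nat.choose 5 2 - 4 = 6 := by
  refine ⟨?_, by decide⟩
  rw [Nat.choose_succ_succ, Nat.choose_one_right, Nat.add_sub_cancel_left]

end Star

section ModuliCount

/-- COROLLARY G (moduli count; note §2.7). If an invertible sheaf on a smooth `Z ⊂ X` (ppav of dimension `g`, `H¹(𝒪_X) ↪ H¹(𝒪_Z)`,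
`Sym²V ⊆ ker ⌟ch`) satisfies (W), then every principally polarized direction lifts `Z`, so `h¹(Z,T_Z) ≥ dim Sym²V = C(g+1,2) = dim 𝒜_g`.
Instance: the Fano surface `F` of lines of a smooth cubic threefold inside its intermediate Jacobian (`g = 5`, `[F] = θ³/3!`,
`h¹(T_F) = 10` as recalled from Clemens–Griffiths): `10 < C(6,2) = 15`, so (W) fails; likewise `3g−3 < C(g+1,2)` for Abel–Jacobi
curves and smooth `W_d`, `g ≥ 4` (`defect_nonhyp_pos_iff`). [folklore] -/
theorem fano_surface_moduli_count : 10 < Nat.choose 6 2 ∧ Nat.choose 6 2 = 15 ∧ 15 - 10 = 5 := by decide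

/-- RIBBON LEMMA, the count (note §2.9). For a ribbon `2C_L` (double structure along a sub-line-bundle `L ⊂ N_{C/X}`) on a smooth curve
`C ⊂ X`: `dim liftable(2C_L) ≤ dim liftable(C) + 2·h⁰(C, L²)`. On an Abel–Jacobi curve of a non-hyperelliptic curve of genus `g`,
`N_C = M_{K_C}^∨` with `M_{K_C}` stable of slope `−2` (Paranjape–Ramanan), so `deg L ≤ 1` and `h⁰(L²) ≤ 1`; hence at most
`(3g−3) + 2 = 3g − 1` principally polarized directions lift the ribbon, and `3g − 1 < g(g+1)/2` iff `g ≥ 5` (stated as `2(3g−1) < g(g+1)`):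
(W) fails for every ribbon on an Abel–Jacobi curve of genus `≥ 5`, while for `g ≥ 6` such ribbons (support cycle `2θ^{g−1}/(g−1)!`) die
along a general principally polarized arc (Welters 1987, Thm. 3.1, with Matsusaka–Ran). [folklore] -/
theorem ribbon_defect_pos_iff (g : ℤ) (hg : 2 ≤ g) : 2 * (3 * g - 1) < g * (g + 1) ↔ 5 ≤ g := by
  constructor
  · intro h
    by_contra hlt
    have hlt' : g < 5 := lt_of_not_ge hlt
    interval_cases g <;> omega
  · intro h; nlinarith

/-- … and the window in which a ribbon could a priori satisfy (W) but no death is available: `g = 4` only (`2(3g−1) ≥ g(g+1)` there, and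
twice the minimal class is effective on every ppav of dimension `≤ 5`, which are Pryms); `g = 5`: (W) already fails. [folklore] -/
theorem ribbon_window_four : ¬ (2 * (3 * (4:ℤ) - 1) < 4 * (4 + 1)) ∧ (2 * (3 * (5:ℤ) - 1) < 5 * (5 + 1)) := by norm_num

end ModuliCount

section AbelPrym

/-!
### Abel–Prym curves (gen-8 note `Q114-ABELIAN-II.md` §3): the class-2γ habitat completed

`π : C̃ → C` étale double cover, `C` non-hyperelliptic of genus `g ≥ 4` (so that `p ≥ 3`, the count `(g−1)(3g−8)/2 > C(p,2)` is
positive and the Prym-dominance statement below makes sense; referee G47), `(P, Ξ)` the Prym variety (ppav of dimension `p = g − 1`), `C̃ ⊂ P` the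
Abel–Prym curve (an embedding for `C̃` non-hyperelliptic, [`LangeBirkenhake1992`, §12 Ex. (16)(i)]), class `2·Ξ^{p−1}/(p−1)!`
= twice the minimal class (Welters' criterion, [`LangeBirkenhake1992`, Thm 12.2.2]). `T₀P = V = H⁰(C, ω_C ⊗ η)^∨`, the projectivised
differential of the Abel–Prym map is the Prym-canonical map `φ_{ω_C⊗η} ∘ π` (ibid. Ex. (14)), and `H¹(P,𝒪) ↪ H¹(C̃,𝒪)` is the
anti-invariant part. PROPOSITION AP (note §3): exactly as for Abel–Jacobi curves (Prop. A of the gen-7 note), the principally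
polarized first-order directions `ξ ∈ Sym²V = (Sym² H⁰(ω_C⊗η))^*` along which `C̃` lifts are
  `L_{C̃} = (ker μ)^⊥ = im(dPr)`,   `μ : Sym² H⁰(C, ω_C ⊗ η) → H⁰(C, ω_C²)` the multiplication map = codifferential of the Prym map
([`Beauville1977`]); hence the (W)-defect of every invertible sheaf on `C̃` is `def(C̃) = dim ker μ` = the number of independent
quadrics containing the Prym-canonical curve, `≥ C(g,2) − (3g−3) = (g−1)(g−6)/2`, with equality iff `μ` is onto (iff `dPr` is
injective at `(C,η)`). CONSEQUENCES: (i) `p ≥ 6` (`g ≥ 7`): (W) FAILS for every invertible sheaf on every Abel–Prym curve, and these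
sheaves DIE along a general principally polarized arc (the Prym locus has dimension `3g − 3 = 3p < p(p+1)/2`, and by Welters 1987 /
Matsusaka–Ran every effective cycle of class `2γ` lives over Jacobians, Pryms and their satellites) — death and ¬(W) together, as in
every abelian habitat so far; (ii) `p ∈ {3,4,5}` and `(C,η)` outside the ramification of the (dominant) Prym map: `def = 0`, (W) HOLDS,
yet `C̃` is NOT semiregular (`h¹(N_{C̃}) ≥ (g−1)(3g−8)/2 > C(p,2) = h^{p−2,p}(P)`, so Bloch's map has a kernel) and `ob` is not
surjective — and the conclusion of the Semiregularity Theorem HOLDS (the pair `(P, C̃)` moves with the cover; `dPr` onto ⟺ no base change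
needed). With the non-simple semi-homogeneous bundles (`SemiregularSemihomogeneousSimple.lean`) these are the natural (W)-but-not-
semiregular survivors on GENERAL ppav of dimension 3, 4, 5: the answer to the first sentence of Question 11.4 is "surjectivity is needed
for semiregularity, not for the conclusion" in both families. The theorems below are the counts.
-/

/-- The Abel–Prym (W)-defect lower bound: `C(g,2) − (3g−3) = (g−1)(g−6)/2` (twice this, over `ℤ`). [folklore] -/
theorem prymDefect_eq (g : ℤ) : (g - 1) * g - 2 * (3 * g - 3) = (g - 1) * (g - 6) := by ring

/-- … positive iff `g ≥ 7`, i.e. iff the Prym variety has dimension `p = g − 1 ≥ 6`: there (W) fails for every invertible sheaf on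
every Abel–Prym curve (the Prym-canonical curve of genus `g ≥ 7` in `ℙ^{g−2}` lies on `≥ (g−1)(g−6)/2 ≥ 3` quadrics). [folklore] -/
theorem prymDefect_pos_iff (g : ℤ) (hg : 2 ≤ g) : 0 < (g - 1) * (g - 6) ↔ 7 ≤ g := by
  constructor
  · intro h
    by_contra hlt
    have hlt' : g < 7 := lt_of_not_ge hlt
    interval_cases g <;> omega
  · intro h; nlinarith

/-- Prym dominance count: `dim R_g = 3g − 3 ≥ dim 𝒜_{g−1} = g(g−1)/2` iff `g ≤ 6` (Pryms are dense in `𝒜_p` exactly for `p ≤ 5`;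
Wirtinger, Donagi–Smith for `g = 6`); in this range a general `(C,η)` has `dPr` onto, `μ` injective, `def(C̃) = 0`: (W) holds. [folklore] -/
theorem prym_dominant_count_iff (g : ℤ) (hg : 2 ≤ g) : (g - 1) * g ≤ 2 * (3 * g - 3) ↔ g ≤ 6 := by
  constructor
  · intro h; nlinarith
  · intro h
    interval_cases g <;> omega

/-- The death range: the Prym locus in `𝒜_p` has dimension `3p` (`= 3g − 3`), a proper subvariety iff `2·3p < p(p+1)` iff `p ≥ 6`;
with Welters' classification of curves of class `2γ` this is where invertible sheaves on Abel–Prym curves die along a general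
principally polarized arc (note §3, Prop. AP (i); gen-7 note §2.9 for the same input). [folklore] -/
theorem prymLocus_proper_iff (p : ℤ) (hp : 1 ≤ p) : 2 * (3 * p) < p * (p + 1) ↔ 6 ≤ p := by
  constructor
  · intro h; nlinarith
  · intro h; nlinarith

/-- NOT SEMIREGULAR for `p ≥ 3`: `h¹(N_{C̃/P}) = (g−1)(2g−1) − rank μ − rank μ′ ≥ (g−1)(2g−1) − C(g,2) − (3g−3) = (g−1)(3g−8)/2`
(`μ′ : H⁰(ω_C⊗η) ⊗ H⁰(ω_C) → H⁰(ω_C²⊗η)` has rank `≤ 3g−3`), and this exceeds `h^{p−2,p}(P) = C(p,2) = (g−1)(g−2)/2`, the target of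
Bloch's semiregularity map `H¹(N) → H^p(Ω^{p−2}_P)`, as soon as `g ≥ 4`: twice the difference is `(g−1)(3g−8) − (g−1)(g−2) =
2(g−1)(g−3) > 0`. Values `(g; bound, C(p,2)) = (4; 6, 3), (5; 14, 6), (6; 25, 10)`. [folklore] -/
theorem abelPrym_not_semiregular_count (g : ℤ) (hg : 4 ≤ g) :
    2 * (g - 1) * (2 * g - 1) - (g - 1) * g - 2 * (3 * g - 3) = (g - 1) * (3 * g - 8) ∧
      (g - 1) * (g - 2) < (g - 1) * (3 * g - 8) ∧
      ((4:ℤ) - 1) * (3 * 4 - 8) / 2 = 6 ∧ ((5:ℤ) - 1) * (3 * 5 - 8) / 2 = 14 ∧ ((6:ℤ) - 1) * (3 * 6 - 8) / 2 = 25 := by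
  refine ⟨by ring, by nlinarith, by norm_num, by norm_num, by norm_num⟩

end AbelPrym

section LocallyFree

variable {𝕜 : Type*} [Field 𝕜] {H E₁ E₂ : Type*} [AddCommGroup H] [Module 𝕜 H] [AddCommGroup E₁] [Module 𝕜 E₁]
  [AddCommGroup E₂] [Module 𝕜 E₂]

/-- PROPOSITION LF (note §2), the linear algebra: for a locally free sheaf `F₀` of any rank on a SMOOTH `Z ⊂ X` and `F = i_*F₀`, the
obstruction map `ob_F : H¹(T_X) → Ext²(F,F)` lands in `F¹Ext² = H¹(Z, 𝓔nd F₀ ⊗ N_Z) = H¹(N_Z) ⊕ H¹(𝓔nd⁰F₀ ⊗ N_Z)` (trace splitting,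
char 0) with FIRST component `ob_Z` (the Atiyah class of `i_*F₀` projects to `id_{F₀} ⊗ π^∨`, `π : T_X|_Z → N_Z`). Hence
`ker ob_F ⊆ ker ob_Z`: if `F` satisfies (W) then `Z` lifts to first order along every `ξ ∈ ker ⌟ch(F) ∩ H¹(T)` — and for a curve
(or any `Z` with `ch(F) ∈ r·ch(𝒪_Z) + H^{2n}`) this is `ker ⌟[Z] ∩ H¹(T)`, so Prop. A / Cor. G / Prop. AP apply verbatim to sheaves of
EVERY rank on Abel–Jacobi curves, smooth `W_d`, the Fano surface and Abel–Prym curves: (W) fails for `F` WHENEVER it fails for `𝒪_Z`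
(the converse — hence "exactly when" — is proved in the note only for CURVES `Z`, where `H²(𝒪_Z) = 0` makes `F¹Ext² → E₂^{1,1}`
the whole obstruction; referee G47) (residual (α′) of the gen-7 note §3 (V3), smooth supports). [folklore] -/
theorem ker_le_ker_of_fst_comp (obF : H →ₗ[𝕜] E₁ × E₂) (obZ : H →ₗ[𝕜] E₁)
    (h : LinearMap.fst 𝕜 E₁ E₂ ∘ₗ obF = obZ) : LinearMap.ker obF ≤ LinearMap.ker obZ := by
  intro u hu
  rw [LinearMap.mem_ker] at hu ⊢
  rw [← h, LinearMap.comp_apply, hu, map_zero]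

/-- … so the (W)-defect of `F` is at least that of `Z`: `dim S − dim(S ∩ ker ob_F) ≥ dim S − dim(S ∩ ker ob_Z)` for the space `S` of
directions that (W) requires to lift (`S = Sym²V` for θ-type classes). [folklore] -/
theorem defect_mono {S K₁ K₂ : Submodule 𝕜 H} [FiniteDimensional 𝕜 H] (h : K₁ ≤ K₂) :
    Module.finrank 𝕜 S - Module.finrank 𝕜 ↥(S ⊓ K₂) ≤ Module.finrank 𝕜 S - Module.finrank 𝕜 ↥(S ⊓ K₁) := by
  have : Module.finrank 𝕜 ↥(S ⊓ K₁) ≤ Module.finrank 𝕜 ↥(S ⊓ K₂) := Submodule.finrank_mono (inf_le_inf_left S h)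
  omega

end LocallyFree

end Literature.AlgebraicGeometry.HodgeTheory.WeakCriterionAbelian
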